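import Summits.HubbardSuperconductivity.HubbardSuperconductivity.Theorems.WeakCouplingBCSKlLindhardBoxCore

/-!
# KL-MARGIN-SCAN reader idea-4 (lens «cascade»), round 10 «kernel-lindhard-box» — CORE PART 2: boundary-cell floors (§2b), quadtree certificates and
# their kernel evaluation (§3), the real-analysis reading `FloorSound` ⇒ floor / hull gate (§4), the explicit Fermi hyperbola (§5), the witness parameters `P_W` (§6)

Part 2/4 of the r10 `Sketch.lean` (sha16 5d52b43bebecde63; crux idea on `stmt-HubbardSuperconductivity-0158`; author hubbard-klscan-idea-4 g10; graded
NEW-COMBINATION/KEEP by hubbard-klscan-crit-1 g3, KL STATUS 2026-08-29 l.11044): Sketch lines 320–605 + `P_W_admissible` VERBATIM (docstrings added on `P_W`,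
`P_W_Xz`; `push_neg` → `push Not`), split out of the Core because the gate caps a Theorems file with proofs at 400 lines (packaging: gate-hubbard-kl-p1 g24).
`FloorSound` is the author's NAMED, UNPROVED soundness hypothesis (the provers' item), exactly as `EnclosuresB1g` is in the `t′ = 0` chain; nothing here asserts it,
a KL margin at any `t′ ≠ 0`, `K₃`, the window or superconductivity; a Kohn–Luttinger `O(U²)` channel statement is not ODLRO and nothing in this file proves
superconductivity in the Hubbard model.
-/

noncomputable section

set_option linter.dupNamespace false

namespace Summit.HubbardSuperconductivity.HubbardSuperconductivity.Theorems.KlLindhardBox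

open Real Set MeasureTheory Literature.MathematicalPhysics.QuantumLattice
open Summit.HubbardSuperconductivity.HubbardSuperconductivity.Theorems
open Summit.HubbardSuperconductivity.HubbardSuperconductivity.Theorems.FSPoly (cosTaylorQ cosLoQ cosUpQ piLoQ cosLoQ_le_cos
  cos_le_cosUpQ cast_cosTaylorQ)
open Summit.HubbardSuperconductivity.HubbardSuperconductivity.Theorems.KlStair (bandQ bandR piUpQ cast_bandQ
  squareDispersion_eq_bandR pi_lt_piUpQ)

/-! ### §2b Boundary cells: integer floors in COSINE COORDINATES (no logarithms; hinted Jacobian bounds)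
On a cell where exactly ONE of the two points straddles its Fermi curve (the other certified occupied or empty), write
`(a, b) = (cos r₀, cos r₁)` for the straddling point `r` (`= p` or `p + q`). Its band is `ε = −2a − S(a)·b`, `S(a) = 2 + 4t′a > 0`
(§5 `band_affine_in_b`), so its Fermi curve is the explicit hyperbola `b = b⋆(a) = −(2a + μ)/S(a)` and `μ − ε = S(a)(b − b⋆(a))`
(§5 `mu_sub_band_eq`). When `cos` is monotone in each coordinate on the cell (`cosDirZ`), `(r₀, r₁) ↦ (a, b)` is a diffeomorphism onto
`A × B ⊇ aIn × bIn` (inner enclosures) with Jacobian factor `1/|sin r₀ sin r₁| ≥ 1/(σx σy)` for the CHECKED hints `σ ≥ |sin|`.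
With the far shell frozen at `Vhi ≥ sup_cell |ε_far − μ|` (rounded up) the crescent part contributes at least
`(1/(σxσy)) Σ_pieces ∫_{a-piece} ∫_{b ∈ crescent} da db / (Vhi + S₁(b − b⋆))`, minorised per a-piece by freezing `b⋆` at its extreme over
the piece (`b⋆` is monotone in `a`), bounding `S ≤ S₁` from above, and minorising the `b`-integral's `log(1+z)/S₁` by `logLo z/S₁`,
`logLo z = 2z/(2+z) ≤ log(1+z)`. Every division is an integer floor/ceiling division in the safe direction. -/

/-- Number of `a`-pieces per boundary cell. [folklore] -/
def MA : ℕ := 8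

/-- UPPER numerator (over `D`) of `S(a) = 2 + 4t′a` at value numerator `a`: `⌈(2 D tpD + 4 tpN a)/tpD⌉`. [folklore] -/
def Params.sUpZ (P : Params) (a : ℤ) : ℤ := cdivZ (2 * D * P.tpD + 4 * P.tpN * a) P.tpD

/-- Positivity test `S(a) > 0` (exact): `0 < 2 D tpD + 4 tpN a`. [folklore] -/
def Params.sPos (P : Params) (a : ℤ) : Bool := decide (0 < 2 * D * P.tpD + 4 * P.tpN * a)

/-- `b⋆(a) = −(2a + μ)/S(a)` as a numerator over `D`, rounded UP: `⌈−(2a·muD + muN·D)·tpD·D / (muD (2D tpD + 4 tpN a))⌉`. [folklore] -/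
def Params.bStarUpZ (P : Params) (a : ℤ) : ℤ :=
  cdivZ (-(2 * a * P.muD + P.muN * D) * P.tpD * D) (P.muD * (2 * D * P.tpD + 4 * P.tpN * a))

/-- `b⋆(a)` rounded DOWN. [folklore] -/
def Params.bStarDnZ (P : Params) (a : ℤ) : ℤ :=
  fdivZ (-(2 * a * P.muD + P.muN * D) * P.tpD * D) (P.muD * (2 * D * P.tpD + 4 * P.tpN * a))

/-- `m`-th point of the integer partition of `[u0, u1]` into `M` pieces (`u0 + ⌊(u1−u0)m/M⌋`; exact at both ends). [folklore] -/
def linGridZ (u0 u1 : ℤ) (M m : ℕ) : ℤ := u0 + fdivZ ((u1 - u0) * (m : ℤ)) (M : ℤ)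

/-- LOWER numerator (over `D`) of `logLo z = 2z/(2+z) ≤ log(1+z)` at `z = Z/D ≥ 0`: `⌊2 Z D/(2D + Z)⌋`. [folklore] -/
def logLoZ (Z : ℤ) : ℤ := fdivZ (2 * Z * D) (2 * D + Z)

/-- One `a`-piece `[α0, α1]/D` of a boundary cell (numerators over `D` in, numerator over `D` out): `occ = true` means the crescent is where the
straddling point is OCCUPIED (`b > b⋆(a)`): `b` runs over `[max(b⋆↑(α0), bIn0), bIn1]`; else over `[bIn0, min(b⋆↓(α1), bIn1)]`. With
`S₁ ≥ max S` on the piece the `b`-integral of `1/(Vhi + S₁·dist)` is `log(1 + z)/S₁ ≥ logLo(z)/S₁`, `z = S₁(b1 − b0)/(Vhi + S₁·(offset))`,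
every quotient floor-divided (`z`, `logLo`, `/S₁` all rounded DOWN; `S₁`, `b⋆` bounds rounded outward). Value `≤ D·∫∫ da db/(…)`. [folklore] -/
def Params.bdryPiece (P : Params) (occ : Bool) (Vhi α0 α1 bIn0 bIn1 : ℤ) : ℤ :=
  let S1 := max (P.sUpZ α0) (P.sUpZ α1)
  let βmax := P.bStarUpZ α0
  let βmin := P.bStarDnZ α1
  if occ then
    let b0 := max βmax bIn0
    let b1 := bIn1
    if b0 < b1 then
      let Z := fdivZ (S1 * (b1 - b0) * D) (Vhi * D + S1 * (b0 - βmin))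
      fdivZ ((α1 - α0) * logLoZ Z) S1
    else 0
  else
    let b0 := bIn0
    let b1 := min βmin bIn1
    if b0 < b1 then
      let Z := fdivZ (S1 * (b1 - b0) * D) (Vhi * D + S1 * (βmax - b1))
      fdivZ ((α1 - α0) * logLoZ Z) S1
    else 0

/-- The BOUNDARY FLOOR TERM (units `2^-30`) of the cell `[x0, x1] × [y0, y1]`: `sh` = the straddling point is `p + q` (else `p`); `occ` = the
crescent part of the cell is where the straddling point is OCCUPIED (then the other point must be certified EMPTY on the cell; else certified
OCCUPIED); `hx, hy` = hinted upper bounds of `|sin r₀|, |sin r₁|` on the cell in units `10⁻⁴`, CHECKED here against the outer cosine ranges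
(`D² − caLo² ≤ σ² D²`). Value `⌊2^30 · 10^8 · Σ_pieces / (hx hy D)⌋` or `0`. [folklore] -/
def Params.bdryTerm (P : Params) (sh occ : Bool) (hx hy : ℕ) (x0 x1 y0 y1 : Pt) : ℤ :=
  match P.ranges x0 x1 y0 y1 with
  | (aLo, aUp, bLo, bUp, aLo', aUp', bLo', bUp') =>
    -- far shell: certified on the required side, with `Vhi ≥ D · sup |ε_far − μ|`
    let farOK : Bool :=
      match sh, occ with
      | false, true => P.muLe (P.bandDnZ aUp' bUp')
      | false, false => P.ltMu (P.bandUpZ aLo' bLo')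
      | true, true => P.muLe (P.bandDnZ aUp bUp)
      | true, false => P.ltMu (P.bandUpZ aLo bLo)
    let Vhi : ℤ :=
      match sh, occ with
      | false, true => P.bandUpZ aLo' bLo' - P.muFl
      | false, false => P.muCl - P.bandDnZ aUp' bUp'
      | true, true => P.bandUpZ aLo bLo - P.muFl
      | true, false => P.muCl - P.bandDnZ aUp bUp
    -- the straddling point's abscissa intervals, inner cosine ranges and |cos| lower bounds (for the Jacobian hints)
    let u0 := if sh then x0.z + P.q1z else x0.z
    let u1 := if sh then x1.z + P.q1z else x1.z
    let v0 := if sh then y0.z + P.q2z else y0.z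
    let v1 := if sh then y1.z + P.q2z else y1.z
    let aIn := if sh then cosInnerZ u0 u1 x0.lo' x0.hi' x1.lo' x1.hi' else cosInnerZ u0 u1 x0.lo x0.hi x1.lo x1.hi
    let bIn := if sh then cosInnerZ v0 v1 y0.lo' y0.hi' y1.lo' y1.hi' else cosInnerZ v0 v1 y0.lo y0.hi y1.lo y1.hi
    let caLo := if sh then absLoZ aLo' aUp' else absLoZ aLo aUp
    let cbLo := if sh then absLoZ bLo' bUp' else absLoZ bLo bUp
    let σx : ℤ := hx
    let σy : ℤ := hy
    let hintsOK := decide ((D ^ 2 - caLo ^ 2) * 10 ^ 8 ≤ σx ^ 2 * D ^ 2) && decide ((D ^ 2 - cbLo ^ 2) * 10 ^ 8 ≤ σy ^ 2 * D ^ 2) &&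
      decide (0 < σx * σy)
    match aIn, bIn with
    | some (aIn0, aIn1), some (bIn0, bIn1) =>
      let guards := P.guard aLo && P.guard aUp && P.guard bLo && P.guard bUp && P.guard aLo' && P.guard aUp' && P.guard bLo' &&
        P.guard bUp'
      let ok := guards && farOK && hintsOK && decide (0 < Vhi) && decide (aIn0 < aIn1) && decide (bIn0 < bIn1) &&
        P.sPos aIn0 && P.sPos aIn1 && decide (-D ≤ aIn0) && decide (aIn1 ≤ D) && decide (0 < P.tpD) && decide (0 < P.muD)
      if ok then
        let total := ((List.range MA).map fun m =>
          P.bdryPiece occ Vhi (linGridZ aIn0 aIn1 MA m) (linGridZ aIn0 aIn1 MA (m + 1)) bIn0 bIn1).sum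
        fdivZ (2 ^ 30 * 10 ^ 8 * total) (σx * σy * D)
      else 0
    | _, _ => 0

/-! ## §3 Quadtree certificates and their kernel evaluation -/

/-- A quadtree certificate: `skip` (claims nothing: contributes 0), `inside k` (claims the current cell lies in ONE shell: `k = true`
means `p` occupied / `p + q` empty), `bdry sh occ hx hy` (a single-straddle boundary cell with its |sin| hints in units `10⁻⁴`), or a `node`
with four children in the order `(x-half, y-half) = (0,0), (1,0), (0,1), (1,1)`. Claims are CHECKED by `eval`; false claims contribute `0`,
so any tree is sound. [folklore] -/
inductive QT where
  | skip : QT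
  | inside (k : Bool) : QT
  | bdry (sh occ : Bool) (hx hy : ℕ) : QT
  | node (c00 c10 c01 c11 : QT) : QT

/-- Compact certificate tokens (keep the literal small): `s` skip. [folklore] -/
def QT.s : QT := QT.skip
/-- `a` = inside, `p` occupied. [folklore] -/
def QT.a : QT := QT.inside true
/-- `b` = inside, `p + q` occupied. [folklore] -/
def QT.b : QT := QT.inside false
/-- `n` = node. [folklore] -/
def QT.n (c00 c10 c01 c11 : QT) : QT := QT.node c00 c10 c01 c11
/-- `e hx hy` = boundary, `p` straddles and is occupied on the crescent (`p + q` empty). [folklore] -/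
def QT.e (hx hy : ℕ) : QT := QT.bdry false true hx hy
/-- `f hx hy` = boundary, `p` straddles, empty on the crescent (`p + q` occupied). [folklore] -/
def QT.f (hx hy : ℕ) : QT := QT.bdry false false hx hy
/-- `g hx hy` = boundary, `p + q` straddles, occupied on the crescent (`p` empty). [folklore] -/
def QT.g (hx hy : ℕ) : QT := QT.bdry true true hx hy
/-- `h hx hy` = boundary, `p + q` straddles, empty on the crescent (`p` occupied). [folklore] -/
def QT.h (hx hy : ℕ) : QT := QT.bdry true false hx hy

/-- Kernel evaluation of a certificate on the cell with corner records `x0, x1, y0, y1`: the sum of the certified leaf terms (units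
`2^-30`). A node builds the two MIDPOINT records (the only place Taylor sums are evaluated) and hands them to its children; disjointness of
the leaves is structural. [folklore] -/
def QT.eval (P : Params) : QT → Pt → Pt → Pt → Pt → ℤ
  | .skip, _, _, _, _ => 0
  | .inside k, x0, x1, y0, y1 => P.leafTerm k x0 x1 y0 y1
  | .bdry sh occ hx hy, x0, x1, y0, y1 => P.bdryTerm sh occ hx hy x0 x1 y0 y1
  | .node c00 c10 c01 c11, x0, x1, y0, y1 =>
      let xm := P.mkX ((x0.z + x1.z) / 2)
      let ym := P.mkY ((y0.z + y1.z) / 2)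
      c00.eval P x0 xm y0 ym + c10.eval P xm x1 y0 ym + c01.eval P x0 xm ym y1 + c11.eval P xm x1 ym y1

/-- Evaluation of a certificate on the ROOT square `[−X, X]²`. [folklore] -/
def Params.rootEval (P : Params) (t : QT) : ℤ := t.eval P (P.mkX (-P.Xz)) (P.mkX P.Xz) (P.mkY (-P.Xz)) (P.mkY P.Xz)

/-- Number of leaves of a certificate (bookkeeping only). [folklore] -/
def QT.leaves : QT → ℕ
  | .skip => 0
  | .inside _ => 1
  | .bdry _ _ _ _ => 1
  | .node a b c d => a.leaves + b.leaves + c.leaves + d.leaves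

/-! ## §4 The real-analysis side: what the kernel number means -/

/-- The transfer momentum `q` as a point of `Momentum = EuclideanSpace ℝ (Fin 2)`. [folklore] -/
def Params.qv (P : Params) : Momentum := WithLp.toLp 2 ![((P.q1 : ℚ) : ℝ), ((P.q2 : ℚ) : ℝ)]

/-- The band `ε_{t′} = squareDispersion 1 t′`. [folklore] -/
def Params.band (P : Params) : Momentum → ℝ := squareDispersion 1 ((P.tp : ℚ) : ℝ)

/-- The two-shell Lindhard integrand of the certificate's `(t′, μ, q)`. [folklore] -/
def Params.integrand (P : Params) : Momentum → ℝ := lindhardIntegrand P.band ((P.mu : ℚ) : ℝ) P.qv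

/-- The grid cell `[toQ z0, toQ z1) × [toQ w0, toQ w1)` as a half-open box of momentum space. [folklore] -/
def cellSet (z0 z1 w0 w1 : ℤ) : Set Momentum :=
  {p | ((toQ z0 : ℚ) : ℝ) ≤ p 0 ∧ p 0 < ((toQ z1 : ℚ) : ℝ) ∧ ((toQ w0 : ℚ) : ℝ) ≤ p 1 ∧ p 1 < ((toQ w1 : ℚ) : ℝ)}

/-- Admissible parameters for a FLOOR certificate: `|t′| ≤ 9/20` (band antitone in each cosine with room for the `≤ 5·10⁻³` enclosure
slack: `−2 < 4t′c` for every enclosure value `c ∈ [−1.005, 1.005]`), `0 < X ≤ piLoQ` (root square inside the Brillouin zone),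
`|q₁|, |q₂| ≤ piLoQ` (every abscissa stays below `2π` in absolute value, the range of validity of `mayMinZ/mayMaxZ/cosDirZ`), positive
denominators, `t′μ < 1` (so `b⋆` is antitone in `a`), and `2^11 ∣ Xz` (every grid point down to depth 11 is integral). All decidable
(integer comparisons). [folklore] -/
def Params.admissible (P : Params) : Bool :=
  decide (0 < P.tpD) && decide (0 < P.muD) && decide (20 * |P.tpN| ≤ 9 * P.tpD) && decide (0 < P.Xz) && decide (P.Xz ≤ PILOZ) &&
    decide (|P.q1z| ≤ PILOZ) && decide (|P.q2z| ≤ PILOZ) && decide (P.Xz % 2048 = 0) && decide (P.tpN * P.muN < P.tpD * P.muD)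

/-- **FLOOR SOUNDNESS** — the line's analytic statement (prover-owned; a named hypothesis below, like `EnclosuresB1g` in the
`t′ = 0` chain): for admissible parameters and ANY quadtree, the kernel number is at most `2^30 · ∫_BZ` of the two-shell
integrand whenever that integrand is integrable. Ingredients: `flZ_le/le_clZ` and the floor/ceiling-division inequalities (`Int.ediv_mul_le`, `Int.lt_ediv_add_one_mul_self`); cosine range lemmas for `cosInfZ/cosSupZ`; r9 antitonicity
`bandR_anti_left/right`; on a certified inside cell the integrand equals `1/g` with `g ≥` a positive constant
(`lindhardIntegrand_eq_ite_inv`); Jensen for `x ↦ 1/x` plus the interpolation bound `avg g ≤ mean of corners + (2/3)(1+2|t′|)s²`; for boundary leaves the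
cosine-coordinate change of variables on the cell (`cos × cos` a bijection by `cosDirZ`, Jacobian `1/|sin r₀ sin r₁| ≥ 1/(σx σy)` by the
checked hints), `cosInnerZ ⊆ image`, `band_lt_iff_bStar_lt` / `mu_sub_band_eq` (§5), `b⋆` antitone, endpoint Riemann minorants;
additivity of the set integral over the four children (`integral_union`, half-open boxes); `cell ⊆ brillouinZone` at the root;
`integrand ≥ 0` (`lindhardIntegrand_nonneg`) for the discarded cells; `⌊·⌋ ≤ ·`. -/
def FloorSound : Prop :=
  ∀ (P : Params) (t : QT), P.admissible = true → IntegrableOn P.integrand brillouinZone volume →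
    ((P.rootEval t : ℤ) : ℝ) ≤ 2 ^ 30 * ∫ p in brillouinZone, P.integrand p

/-- From `FloorSound`: a certificate value `N = P.rootEval t` bounds the Lindhard function from below,
`N / (2^30 (2·piUpQ)²) ≤ χ₀(q; μ, t′)`, when the integrand is integrable. [folklore] -/
theorem floor_le_lindhard (hS : FloorSound) (P : Params) (t : QT) (hP : P.admissible = true)
    (hint : IntegrableOn P.integrand brillouinZone volume) :
    ((P.rootEval t : ℤ) : ℝ) / (2 ^ 30 * (2 * ((piUpQ : ℚ) : ℝ)) ^ 2) ≤
      lindhardFunction P.band ((P.mu : ℚ) : ℝ) P.qv := by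
  have h := hS P t hP hint
  have hpi : (2 * π) ^ 2 ≤ (2 * ((piUpQ : ℚ) : ℝ)) ^ 2 := by
    have := pi_lt_piUpQ
    have h0 : 0 ≤ 2 * π := by positivity
    exact pow_le_pow_left₀ h0 (by linarith) 2
  have hI : ((P.rootEval t : ℤ) : ℝ) / 2 ^ 30 ≤ ∫ p in brillouinZone, P.integrand p := by
    rw [div_le_iff₀ (by positivity)]; linarith
  unfold lindhardFunction
  have hpos : (0 : ℝ) < (2 * π) ^ 2 := by positivity
  have hpos' : (0 : ℝ) < (2 * ((piUpQ : ℚ) : ℝ)) ^ 2 := lt_of_lt_of_le hpos hpi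
  by_cases hN : ((P.rootEval t : ℤ) : ℝ) ≤ 0
  · -- a non-positive certificate value is trivially below `χ₀ ≥ 0`
    have hχ : 0 ≤ (∫ p in brillouinZone, P.integrand p) / (2 * π) ^ 2 :=
      div_nonneg (integral_nonneg fun p => lindhardIntegrand_nonneg _ _ _ p) hpos.le
    exact le_trans (div_nonpos_of_nonpos_of_nonneg hN (by positivity)) hχ
  · push Not at hN
    calc ((P.rootEval t : ℤ) : ℝ) / (2 ^ 30 * (2 * ((piUpQ : ℚ) : ℝ)) ^ 2)
        = (((P.rootEval t : ℤ) : ℝ) / 2 ^ 30) / (2 * ((piUpQ : ℚ) : ℝ)) ^ 2 := by rw [div_div]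
      _ ≤ (((P.rootEval t : ℤ) : ℝ) / 2 ^ 30) / (2 * π) ^ 2 := by
          apply div_le_div_of_nonneg_left (by positivity) hpos hpi
      _ ≤ (∫ p in brillouinZone, P.integrand p) / (2 * π) ^ 2 := div_le_div_of_nonneg_right hI hpos.le

/-- **Hull exclusion by the Bochner dichotomy** (no integrability lemma needed): if a certificate value `N` satisfies
`hi · 2^30 (2·piUpQ)² < N` and `0 < lo`, then `χ₀ ∉ [lo, hi]` — if the integrand is integrable `χ₀ ≥ N/(2^30(2π)²) > hi`, and if
not, `χ₀ = 0 < lo` (junk value of the Bochner integral). This is the kernel-side CONTAINMENT GATE a hull row `[lo, hi]` at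
`(μ, t′, q)` must pass. [folklore] -/
theorem hull_excluded (hS : FloorSound) (P : Params) (t : QT) (hP : P.admissible = true) (lo hi : ℚ) (hlo : 0 < lo)
    (hhi : hi * (2 ^ 30 * (2 * piUpQ) ^ 2) < P.rootEval t) :
    ¬ (((lo : ℚ) : ℝ) ≤ lindhardFunction P.band ((P.mu : ℚ) : ℝ) P.qv ∧
        lindhardFunction P.band ((P.mu : ℚ) : ℝ) P.qv ≤ ((hi : ℚ) : ℝ)) := by
  rintro ⟨h1, h2⟩
  by_cases hint : IntegrableOn P.integrand brillouinZone volume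
  · have hf := floor_le_lindhard hS P t hP hint
    have hhi' : ((hi : ℚ) : ℝ) * (2 ^ 30 * (2 * ((piUpQ : ℚ) : ℝ)) ^ 2) < ((P.rootEval t : ℤ) : ℝ) := by
      have := (Rat.cast_lt (K := ℝ)).2 hhi
      push_cast at this
      linarith
    have hpos : (0 : ℝ) < 2 ^ 30 * (2 * ((piUpQ : ℚ) : ℝ)) ^ 2 := by
      have := pi_lt_piUpQ; have : (0:ℝ) < ((piUpQ : ℚ) : ℝ) := lt_trans pi_pos this; positivity
    have : ((hi : ℚ) : ℝ) < ((P.rootEval t : ℤ) : ℝ) / (2 ^ 30 * (2 * ((piUpQ : ℚ) : ℝ)) ^ 2) := by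
      rw [lt_div_iff₀ hpos]; exact hhi'
    linarith
  · have h0 : lindhardFunction P.band ((P.mu : ℚ) : ℝ) P.qv = 0 := by
      unfold lindhardFunction
      rw [show (∫ p in brillouinZone, lindhardIntegrand P.band ((P.mu : ℚ) : ℝ) P.qv p) = 0 from integral_undef hint, zero_div]
    have : (0 : ℝ) < ((lo : ℚ) : ℝ) := by exact_mod_cast hlo
    linarith

/-! ## §5 The explicit Fermi curve in cosine coordinates (anchor of the second-order boundary cells) -/

/-- `S(a) = 2 + 4t′a`, the (positive, for `|t′| < 1/2` and `|a| ≤ 1`) slope of `−ε` in the second cosine. [folklore] -/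
def slopeS (tp a : ℝ) : ℝ := 2 + 4 * tp * a

/-- `b⋆(a) = −(2a + μ)/(2 + 4t′a)`: the Fermi curve `{ε = μ}` as an explicit graph in cosine coordinates. [folklore] -/
def bStar (tp μ a : ℝ) : ℝ := -(2 * a + μ) / slopeS tp a

/-- The band is affine in the second cosine: `ε(a, b) = −2a − S(a)·b`. [folklore] -/
theorem band_affine_in_b (tp a b : ℝ) : bandR tp a b = -2 * a - slopeS tp a * b := by
  unfold bandR slopeS; ring

/-- `0 < S(a)` for `|t′| ≤ 1/2`, `|a| ≤ 1` unless `|t′| = 1/2 ∧ |a| = 1`; here the convenient strict form `|t′| < 1/2`. [folklore] -/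
theorem slopeS_pos {tp a : ℝ} (htp : |tp| < 1 / 2) (ha : |a| ≤ 1) : 0 < slopeS tp a := by
  unfold slopeS
  have h1 : |tp * a| ≤ |tp| := by
    rw [abs_mul]; exact mul_le_of_le_one_right (abs_nonneg _) ha
  have h2 : -(1 / 2) < tp * a := by
    have := neg_abs_le (tp * a); linarith
  linarith

/-- **Occupied iff above the hyperbola**: for `0 < S(a)`, `ε(a, b) < μ ↔ b⋆(a) < b` — the occupied side of the Fermi curve is
`{b > b⋆(a)}` in cosine coordinates, and `μ − ε = S(a)·(b − b⋆(a))` is AFFINE in `b` (so `∫ db/(V + |u|)` is an explicit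
logarithm). [folklore] -/
theorem band_lt_iff_bStar_lt {tp μ a b : ℝ} (hS : 0 < slopeS tp a) : bandR tp a b < μ ↔ bStar tp μ a < b := by
  rw [band_affine_in_b, bStar, div_lt_iff₀ hS]
  constructor <;> intro h <;> nlinarith

/-- The distance to the level in cosine coordinates: `μ − ε(a,b) = S(a)·(b − b⋆(a))`. [folklore] -/
theorem mu_sub_band_eq {tp μ a b : ℝ} (hS : 0 < slopeS tp a) : μ - bandR tp a b = slopeS tp a * (b - bStar tp μ a) := by
  rw [band_affine_in_b, bStar]
  field_simp
  ring

/-! ## §6 The witness point of margin-1's retraction (STATUS l.10498): `t′ = −3/10`, `μ = −2399/2500 = −0.9596` (inside the μ-cell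
`[−0.95960693, −0.95959930]` of j320108), `q = (−61/50, 67/40) = (−1.22, 1.675)`; root half-width `X = 6281216/2·10⁶ = 3.140608 ≤ piLoQ`.
The certificate `T_W` (depth 10, 18 173 inside + 6 647 boundary leaves, generated by `r10/calc/emit_qtz.py witness 4 10 3 W`, TOLC 0.003,
MA = 8) is split into 52 sub-certificates rooted at the depth-3 cells (each ONE `decide +kernel`) and re-assembled by `simp only`. -/

/-- The witness parameters `P_W = (t′, μ, q, X) = (−3/10, −2399/2500, (−61/50, 67/40), 6281216/2·10⁶)` of §6 (idea-4 r10). -/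
def P_W : Params := ⟨-3, 10, -2399, 2500, -2440000, 3350000, 6281216⟩
/-- `P_W.Xz = 6281216` (by `rfl`; used by the certificate re-assembly). -/
theorem P_W_Xz : P_W.Xz = 6281216 := rfl

/-- The certificate's parameters are admissible. [folklore] -/
theorem P_W_admissible : P_W.admissible = true := by decide +kernel

end Summit.HubbardSuperconductivity.HubbardSuperconductivity.Theorems.KlLindhardBox

end
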